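import Summits.MatrixMultiplication.MatrixMultiplication.Theorems.SoloBlindConjEReduction

/-!
# Group-test packings certify the Kraft inequality (Tuza's inequality at `p = 1/2`)

Sub-programme (K₃) (Kraft inequality `K(τ; S) = ∑_{T ⊆ S, ∑_T h = τ} 2^{-|T|} ≤ 1` for zero-sum-free
sequences over `𝔽₃`; `soloBlindMass`).

A CERTIFICATE on a finite question set `Q` is a partial answer sheet `c : Q → Option Bool`; two certificates
CONFLICT when some question is answered by both with different answers.  Conflicting certificates have disjoint
cubes in `{0,1}^Q`, so a family of pairwise conflicting certificates satisfies the KRAFT INEQUALITY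
`∑_i 2^{-|support c_i|} ≤ 1` (`soloBlind_kraft_of_conflicting`; this is Tuza's inequality for weakly
cross-intersecting set-pair systems at `p = 1/2`).  The proof is the averaging identity
`2^{-|support c|} = ∑_ω ∏_q factor_c(q, ω q)` (`Fintype.prod_sum`) followed by "at most one certificate of a
conflicting family has a non-zero product at a given `ω`".

A GROUP-TEST PACKING of a set family `(T_i)` over a ground type `X` with questions `qs : Q → Finset X` assigns to
each member a set `hold i` of at most `|T_i|` questions such that any two members hold a common question `q` on
which their group-test answers "does `T` meet `qs q`?" differ.  The induced certificates conflict, hence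
`∑_i 2^{-|T_i|} ≤ 1` (`soloBlind_kraft_of_groupTestPacking`), and for the representation family of a target this
is `K(τ; S) ≤ 1` (`soloBlind_mass_le_one_of_groupTestPacking`).  Group-test Kraft TREES are the hierarchical
special case; they do not exist for the rank-5 configuration
`S⋆ = {e₁,…,e₅} ∪ {eᵢ + e₅ : i ≤ 4} ∪ {f = e₁+e₂+e₃+e₄}`, `τ = f`, but a (non-hierarchical) packing with nine
questions does: `soloBlind_sstar_groupTestPacking` (kernel-checked by `decide`), and `soloBlind_sstar_reps`
identifies the packed family with the representation family of `f`.
-/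

namespace Summit.MatrixMultiplication.MatrixMultiplication.Theorems

open Finset

universe u

section Certificates

variable {Q : Type*} [Fintype Q]

/-- The support of a certificate: the questions it answers. -/
def soloBlindCertSupport (c : Q → Option Bool) : Finset Q :=
  Finset.univ.filter (fun q => c q ≠ none)

/-- Two certificates conflict: some question is answered by both, with different answers. -/
def soloBlindCertConflict (c c' : Q → Option Bool) : Prop :=
  ∃ q a b, c q = some a ∧ c' q = some b ∧ a ≠ b

/-- Weight factor of a certificate at a question for a proposed answer: `1/2` if the certificate leaves the
question open or prescribes that answer, `0` otherwise. -/
def soloBlindCertFactor (c : Q → Option Bool) (q : Q) (b : Bool) : ℚ :=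
  if c q = none ∨ c q = some b then 1 / 2 else 0

omit [Fintype Q] in
/-- The factor is non-negative. -/
theorem soloBlind_certFactor_nonneg (c : Q → Option Bool) (q : Q) (b : Bool) :
    0 ≤ soloBlindCertFactor c q b := by
  unfold soloBlindCertFactor; split_ifs <;> norm_num

omit [Fintype Q] in
/-- The factor is at most `1/2`. -/
theorem soloBlind_certFactor_le (c : Q → Option Bool) (q : Q) (b : Bool) :
    soloBlindCertFactor c q b ≤ 1 / 2 := by
  unfold soloBlindCertFactor; split_ifs <;> norm_num

omit [Fintype Q] in
/-- The factor is non-zero exactly when the answer is compatible with the certificate. -/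
theorem soloBlind_certFactor_ne_zero_iff (c : Q → Option Bool) (q : Q) (b : Bool) :
    soloBlindCertFactor c q b ≠ 0 ↔ (c q = none ∨ c q = some b) := by
  unfold soloBlindCertFactor
  split_ifs with h
  · simp [h]
  · simp [h]

omit [Fintype Q] in
/-- Summing the factor over both answers: an open question contributes `1`, an answered one `1/2`. -/
theorem soloBlind_certFactor_sum (c : Q → Option Bool) (q : Q) :
    ∑ b, soloBlindCertFactor c q b = if c q = none then 1 else 1 / 2 := by
  rw [Fintype.sum_bool]
  unfold soloBlindCertFactor
  rcases c q with _ | a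
  · norm_num
  · cases a <;> simp

/-- `∏_q ∑_b factor = 2^{-|support|}`. -/
theorem soloBlind_cert_prod_sum (c : Q → Option Bool) :
    ∏ q, ∑ b, soloBlindCertFactor c q b = (1 / 2 : ℚ) ^ (soloBlindCertSupport c).card := by
  simp_rw [soloBlind_certFactor_sum]
  rw [Finset.prod_ite, Finset.prod_const_one, one_mul, Finset.prod_const]
  rfl

/-- The averaging identity `2^{-|support c|} = ∑_ω ∏_q factor_c(q, ω q)`. -/
theorem soloBlind_cert_weight_eq_sum [DecidableEq Q] (c : Q → Option Bool) :
    (1 / 2 : ℚ) ^ (soloBlindCertSupport c).card = ∑ ω : Q → Bool, ∏ q, soloBlindCertFactor c q (ω q) := by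
  rw [← soloBlind_cert_prod_sum, Fintype.prod_sum (fun q b => soloBlindCertFactor c q b)]

/-- Each cube product is at most `2^{-|Q|}`. -/
theorem soloBlind_cert_prod_le (c : Q → Option Bool) (ω : Q → Bool) :
    ∏ q, soloBlindCertFactor c q (ω q) ≤ (1 / 2 : ℚ) ^ Fintype.card Q := by
  calc ∏ q, soloBlindCertFactor c q (ω q) ≤ ∏ _q : Q, (1 / 2 : ℚ) :=
        Finset.prod_le_prod (fun q _ => soloBlind_certFactor_nonneg c q (ω q))
          (fun q _ => soloBlind_certFactor_le c q (ω q))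
    _ = (1 / 2 : ℚ) ^ Fintype.card Q := by rw [Finset.prod_const, Finset.card_univ]

/-- Conflicting certificates have disjoint cubes: if the product of `c` at `ω` is non-zero, the product of a
conflicting `c'` at `ω` vanishes. -/
theorem soloBlind_cert_prod_eq_zero_of_conflict {c c' : Q → Option Bool} (h : soloBlindCertConflict c c')
    (ω : Q → Bool) (hne : ∏ q, soloBlindCertFactor c q (ω q) ≠ 0) :
    ∏ q, soloBlindCertFactor c' q (ω q) = 0 := by
  obtain ⟨q, a, b, hq, hq', hab⟩ := h
  have h1 : soloBlindCertFactor c q (ω q) ≠ 0 :=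
    fun h0 => hne (Finset.prod_eq_zero (Finset.mem_univ q) h0)
  have h1' := (soloBlind_certFactor_ne_zero_iff c q (ω q)).mp h1
  rw [hq] at h1'
  have hωq : ω q = a := by
    rcases h1' with h1' | h1'
    · exact absurd h1' (Option.some_ne_none a)
    · exact (Option.some_injective _ h1').symm
  apply Finset.prod_eq_zero (Finset.mem_univ q)
  by_contra h2
  have h3 := (soloBlind_certFactor_ne_zero_iff c' q (ω q)).mp h2
  rw [hq', hωq] at h3
  rcases h3 with h3 | h3
  · exact Option.some_ne_none _ h3
  · exact hab (Option.some_injective _ h3).symm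

/-- TUZA'S INEQUALITY AT `p = 1/2` (disjoint cubes): a finite family of pairwise conflicting certificates
satisfies the Kraft inequality `∑_i 2^{-|support c_i|} ≤ 1`. -/
theorem soloBlind_kraft_of_conflicting {ι : Type*} (I : Finset ι) (c : ι → Q → Option Bool)
    (hconf : ∀ i ∈ I, ∀ j ∈ I, i ≠ j → soloBlindCertConflict (c i) (c j)) :
    ∑ i ∈ I, (1 / 2 : ℚ) ^ (soloBlindCertSupport (c i)).card ≤ 1 := by
  classical
  have key : ∀ i ∈ I, (1 / 2 : ℚ) ^ (soloBlindCertSupport (c i)).card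
      = ∑ ω : Q → Bool, ∏ q, soloBlindCertFactor (c i) q (ω q) :=
    fun i _ => soloBlind_cert_weight_eq_sum (c i)
  rw [Finset.sum_congr rfl key, Finset.sum_comm]
  have hω : ∀ ω : Q → Bool,
      ∑ i ∈ I, ∏ q, soloBlindCertFactor (c i) q (ω q) ≤ (1 / 2 : ℚ) ^ Fintype.card Q := by
    intro ω
    by_cases hex : ∃ i ∈ I, ∏ q, soloBlindCertFactor (c i) q (ω q) ≠ 0
    · obtain ⟨i, hi, hne⟩ := hex
      rw [← Finset.add_sum_erase I _ hi]
      have hrest : ∑ j ∈ I.erase i, ∏ q, soloBlindCertFactor (c j) q (ω q) = 0 := by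
        apply Finset.sum_eq_zero
        intro j hj
        exact soloBlind_cert_prod_eq_zero_of_conflict
          (hconf i hi j (Finset.mem_of_mem_erase hj) (Finset.ne_of_mem_erase hj).symm) ω hne
      rw [hrest, add_zero]
      exact soloBlind_cert_prod_le (c i) ω
    · push Not at hex
      rw [Finset.sum_eq_zero hex]
      positivity
  calc ∑ ω : Q → Bool, ∑ i ∈ I, ∏ q, soloBlindCertFactor (c i) q (ω q)
      ≤ ∑ _ω : Q → Bool, (1 / 2 : ℚ) ^ Fintype.card Q := Finset.sum_le_sum (fun ω _ => hω ω)
    _ = 1 := by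
      rw [Finset.sum_const, Finset.card_univ, Fintype.card_fun, Fintype.card_bool, nsmul_eq_mul]
      push_cast
      rw [← mul_pow]
      norm_num

end Certificates

section Packings

variable {X : Type*} [DecidableEq X] {Q : Type*}

/-- The group-test answer of a set `T` to the question `q`: does `T` meet the question set `qs q`? -/
def soloBlindGTAnswer (qs : Q → Finset X) (T : Finset X) (q : Q) : Bool :=
  decide (∃ x ∈ qs q, x ∈ T)

/-- The certificate induced by a set `T` holding the questions `H`: its group-test answers on `H`. -/
def soloBlindGTCert [DecidableEq Q] (qs : Q → Finset X) (T : Finset X) (H : Finset Q) : Q → Option Bool :=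
  fun q => if q ∈ H then some (soloBlindGTAnswer qs T q) else none

/-- The support of the induced certificate is the set of held questions. -/
theorem soloBlind_gtCert_support [Fintype Q] [DecidableEq Q] (qs : Q → Finset X) (T : Finset X)
    (H : Finset Q) : soloBlindCertSupport (soloBlindGTCert qs T H) = H := by
  ext q
  simp [soloBlindCertSupport, soloBlindGTCert]

/-- Sets with different answers on a commonly held question induce conflicting certificates. -/
theorem soloBlind_gtCert_conflict [DecidableEq Q] (qs : Q → Finset X) {T T' : Finset X} {H H' : Finset Q} {q : Q}
    (hq : q ∈ H) (hq' : q ∈ H') (hne : soloBlindGTAnswer qs T q ≠ soloBlindGTAnswer qs T' q) :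
    soloBlindCertConflict (soloBlindGTCert qs T H) (soloBlindGTCert qs T' H') :=
  ⟨q, soloBlindGTAnswer qs T q, soloBlindGTAnswer qs T' q,
    by simp [soloBlindGTCert, hq], by simp [soloBlindGTCert, hq'], hne⟩

/-- A GROUP-TEST PACKING of an indexed set family: member `i` holds at most `|T_i|` questions, and any two
members hold a common question on which their group-test answers differ. -/
def soloBlindIsGroupTestPacking {κ : Type*} (qs : Q → Finset X) (rep : κ → Finset X)
    (hold : κ → Finset Q) : Prop :=
  (∀ i, (hold i).card ≤ (rep i).card) ∧
  (∀ i j, i ≠ j → ∃ q ∈ hold i, q ∈ hold j ∧ soloBlindGTAnswer qs (rep i) q ≠ soloBlindGTAnswer qs (rep j) q)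

/-- KRAFT FROM A GROUP-TEST PACKING (indexed form): `∑_i 2^{-|T_i|} ≤ 1`. -/
theorem soloBlind_kraft_of_groupTestPacking [Fintype Q] [DecidableEq Q] {κ : Type*} [Fintype κ] (qs : Q → Finset X)
    (rep : κ → Finset X) (hold : κ → Finset Q) (hP : soloBlindIsGroupTestPacking qs rep hold) :
    ∑ i, (1 / 2 : ℚ) ^ (rep i).card ≤ 1 := by
  classical
  obtain ⟨hbud, hconf⟩ := hP
  have hc : ∀ i ∈ (Finset.univ : Finset κ), ∀ j ∈ (Finset.univ : Finset κ), i ≠ j →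
      soloBlindCertConflict (soloBlindGTCert qs (rep i) (hold i)) (soloBlindGTCert qs (rep j) (hold j)) := by
    intro i _ j _ hij
    obtain ⟨q, hq, hq', hne⟩ := hconf i j hij
    exact soloBlind_gtCert_conflict qs hq hq' hne
  calc ∑ i, (1 / 2 : ℚ) ^ (rep i).card
      ≤ ∑ i, (1 / 2 : ℚ) ^ (soloBlindCertSupport (soloBlindGTCert qs (rep i) (hold i))).card := by
        apply Finset.sum_le_sum
        intro i _
        rw [soloBlind_gtCert_support]
        exact pow_le_pow_of_le_one (by norm_num) (by norm_num) (hbud i)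
    _ ≤ 1 := soloBlind_kraft_of_conflicting Finset.univ _ hc

/-- KRAFT FROM A GROUP-TEST PACKING (set-family form): if every member `T` of a finite set family holds at most
`|T|` questions (`hold T`) and distinct members differ on a commonly held question, then `∑_{T ∈ F} 2^{-|T|} ≤ 1`. -/
theorem soloBlind_kraft_of_groupTestPacking_family [Fintype Q] [DecidableEq Q] (qs : Q → Finset X) (F : Finset (Finset X))
    (hold : Finset X → Finset Q) (hbud : ∀ T ∈ F, (hold T).card ≤ T.card)
    (hconf : ∀ T ∈ F, ∀ T' ∈ F, T ≠ T' →
      ∃ q ∈ hold T, q ∈ hold T' ∧ soloBlindGTAnswer qs T q ≠ soloBlindGTAnswer qs T' q) :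
    ∑ T ∈ F, (1 / 2 : ℚ) ^ T.card ≤ 1 := by
  classical
  have hc : ∀ T ∈ F, ∀ T' ∈ F, T ≠ T' →
      soloBlindCertConflict (soloBlindGTCert qs T (hold T)) (soloBlindGTCert qs T' (hold T')) := by
    intro T hT T' hT' hne
    obtain ⟨q, hq, hq', hne'⟩ := hconf T hT T' hT' hne
    exact soloBlind_gtCert_conflict qs hq hq' hne'
  calc ∑ T ∈ F, (1 / 2 : ℚ) ^ T.card
      ≤ ∑ T ∈ F, (1 / 2 : ℚ) ^ (soloBlindCertSupport (soloBlindGTCert qs T (hold T))).card := by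
        apply Finset.sum_le_sum
        intro T hT
        rw [soloBlind_gtCert_support]
        exact pow_le_pow_of_le_one (by norm_num) (by norm_num) (hbud T hT)
    _ ≤ 1 := soloBlind_kraft_of_conflicting F _ hc

/-- (K₃) FROM A GROUP-TEST PACKING OF THE FIBRE: if the representation family of `τ` on `S` admits a group-test
packing, then `K(τ; S) ≤ 1`. -/
theorem soloBlind_mass_le_one_of_groupTestPacking [Fintype Q] [DecidableEq Q] {G : Type u} [AddCommGroup G]
    [DecidableEq G] (h : X → G) (S : Finset X) (τ : G) (qs : Q → Finset X)
    (hold : Finset X → Finset Q) (hbud : ∀ T ∈ soloBlindSeqRepAll h S τ, (hold T).card ≤ T.card)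
    (hconf : ∀ T ∈ soloBlindSeqRepAll h S τ, ∀ T' ∈ soloBlindSeqRepAll h S τ, T ≠ T' →
      ∃ q ∈ hold T, q ∈ hold T' ∧ soloBlindGTAnswer qs T q ≠ soloBlindGTAnswer qs T' q) :
    soloBlindMass h S τ ≤ 1 :=
  soloBlind_kraft_of_groupTestPacking_family qs _ hold hbud hconf

end Packings

section SStar

/-- The rank-5 configuration `S⋆` (indices `0–3 ↦ e₁..e₄`, `4–7 ↦ e₁+e₅..e₄+e₅`, `8 ↦ e₅`,
`9 ↦ f = e₁+e₂+e₃+e₄`) in `𝔽₃⁵`. -/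
def soloBlindSStar : Fin 10 → (Fin 5 → ZMod 3) :=
  ![![1, 0, 0, 0, 0], ![0, 1, 0, 0, 0], ![0, 0, 1, 0, 0], ![0, 0, 0, 1, 0],
    ![1, 0, 0, 0, 1], ![0, 1, 0, 0, 1], ![0, 0, 1, 0, 1], ![0, 0, 0, 1, 1],
    ![0, 0, 0, 0, 1], ![1, 1, 1, 1, 0]]

/-- The target `f = e₁+e₂+e₃+e₄`. -/
def soloBlindSStarTarget : Fin 5 → ZMod 3 := ![1, 1, 1, 1, 0]

/-- The twelve representations of `f` in `S⋆`. -/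
def soloBlindSStarRep : Fin 12 → Finset (Fin 10) :=
  ![{9}, {0, 1, 2, 3}, {3, 4, 5, 6}, {2, 4, 5, 7}, {1, 4, 6, 7}, {0, 5, 6, 7},
    {2, 3, 4, 5, 8}, {1, 3, 4, 6, 8}, {1, 2, 4, 7, 8}, {0, 3, 5, 6, 8}, {0, 2, 5, 7, 8}, {0, 1, 6, 7, 8}]

/-- The nine group-test questions of the packing (`0`: `{f}`; `1`: `{e₁}`; `2`: `{e₄}`; `3`: `{e₃, e₅}`;
`4`: `{e₂, e₄}`; `5`: `{e₁, e₂, e₃+e₅}`; `6`: `{e₁, e₄, e₅}`; `7`: `{e₂, e₃, e₁+e₅}`; `8`: `{e₁+e₅, e₃+e₅}`). -/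
def soloBlindSStarQuestion : Fin 9 → Finset (Fin 10) :=
  ![{9}, {0}, {3}, {2, 8}, {1, 3}, {0, 1, 6}, {0, 3, 8}, {1, 2, 4}, {4, 6}]

/-- The questions held by each representation (a "coordinate tree with one defector": question `1` is held
by every non-singleton representation except `{2, 4, 5, 7}`). -/
def soloBlindSStarHold : Fin 12 → Finset (Fin 9) :=
  ![{0}, {0, 1, 4, 8}, {0, 1, 3, 6}, {0, 3, 4, 5}, {0, 1, 3, 6}, {0, 1, 3, 4},
    {0, 1, 3, 4, 5}, {0, 1, 2, 3, 5}, {0, 1, 2, 3, 5}, {0, 1, 4, 7, 8}, {0, 1, 3, 4, 5}, {0, 1, 4, 7, 8}]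

/-- KERNEL CERTIFICATE: the held questions form a group-test packing of the twelve representations
(budgets `|hold i| ≤ |T_i|`, and every pair conflicts on a commonly held question). -/
theorem soloBlind_sstar_groupTestPacking :
    soloBlindIsGroupTestPacking soloBlindSStarQuestion soloBlindSStarRep soloBlindSStarHold := by
  unfold soloBlindIsGroupTestPacking soloBlindGTAnswer
  decide +kernel

/-- The packed family is exactly the representation family of `f` in `S⋆` (all `T ⊆ S⋆` with `∑_T = f`). -/
theorem soloBlind_sstar_reps :
    soloBlindSeqRepAll soloBlindSStar Finset.univ soloBlindSStarTarget
      = Finset.univ.image soloBlindSStarRep := by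
  unfold soloBlindSeqRepAll soloBlindSStar soloBlindSStarTarget soloBlindSStarRep
  decide +kernel

/-- Consequence: `∑_i 2^{-|T_i|} ≤ 1` over the twelve representations, from the packing alone. -/
theorem soloBlind_sstar_kraft :
    ∑ i, (1 / 2 : ℚ) ^ (soloBlindSStarRep i).card ≤ 1 :=
  soloBlind_kraft_of_groupTestPacking _ _ _ soloBlind_sstar_groupTestPacking

end SStar

end Summit.MatrixMultiplication.MatrixMultiplication.Theorems
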